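import Mathlib
import Summits.NavierStokesRegularity.NavierStokesRegularity.Theorems.RootDecompLitSliceLocalWindowTradeoff
import HarnessLib

/-!
# Route RootDecompLitSlice — cell Uᶜ `CritTameScarIsCritical` (stmt-NavierStokesRegularity-31733):
# the E-LETTER CONDITIONAL FACE «energy-Type-I vertices ⟹ Uᶜ» over the local trade-off STℓ

Helper toward the Tao-vacuous cell Uᶜ (`--supports 31733`; no item, no node, no registered stub; decomp-ns
census g56, tree probe #50d, critic rows 717/721).  The landed STℓ `LocalWindowTradeoff.localWindowTradeoff`
(`∫_{B_r}|u(T)|² ≤ 2H + 16(r²/(ντ))·L + c₀(r/ρ)²(H + ∫_{B_ρ}|u(T)|²)`, `L` a local dissipation HYPOTHESIS number)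
is run at CONSTANT aperture `ρ = M₀ r`, `M₀ = max 4 (2c₀)`, and PARABOLIC window `τ = r²`; with the √-clock
(`H = K√τ = K r`) and a PARABOLIC-LOCAL DISSIPATION bound at the vertex (`∫⁻_{(T−ρ²,T)}∫⁻_{B_ρ(x₀)}|∇u|²_F ≤ C·ρ`,
i.e. CKN's scale-invariant dissipation quantity `E(ρ; x₀, T)` bounded — «energy-Type-I at the vertex» in the
E letter, cf. Seregin 2014 Prop. 3.11(ii)) the recursion `scar(r) ≤ A·r + (c₀/M₀²)·scar(M₀ r)` CONTRACTS and an
induction on scales gives ORDER EXACTLY 1 — no exponent bookkeeping: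

* `EnergyTypeIVertex.induction_on_scales` — abstract constant-aperture recursion lemma;
* `EnergyTypeIVertex.critScar_of_sqrtClock_of_parabolicDissipation` — classical Leray–Hopf frame + √-clock
  + E-bound at `x₀` ⟹ `r⁻¹∫_{B_r(x₀)}|u(T)|² ≤ M` for small `r`;
* `EnergyTypeIVertex.critTameScarIsCritical_of_parabolicDissipation` — the CELL FORM: Uᶜ's frame, clock
  hypothesis and conclusion verbatim with ONE inserted antecedent (the E-bound at every vertex).

READING.  Together with the swapped approximation principle (Uᶜ's conclusion ⟹ the parabolic budget
`sup_r A(r;x₀,T) < ∞`) and the printed one-quantity theorem (A-, C-, E-boundedness are interchangeable for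
suitable weak solutions, Seregin 2014 Prop. 3.11(ii)), this says: modulo that printed theorem, Uᶜ is EQUIVALENT to
«every vertex of a √-clocked tame first blow-up is energy-Type-I»; the open content of Uᶜ is a √-clocked tame
first blow-up with an energy-Type-II vertex.  HONEST FRAMING: a conditional face (CL / DL½ class); zero load of the
route moves (ROOT ⟺ U ∧ P1; loads Uᵃ ⟨31734⟩ + P1 ⟨1217⟩); closes nothing.  Rung 0: nothing here proves NS
regularity. [folklore]
-/

set_option linter.dupNamespace false

noncomputable section

namespace Summit.NavierStokesRegularity.NavierStokesRegularity.Theorems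

open MeasureTheory Set Metric Filter Topology
open scoped ENNReal
open Literature.Analysis.FluidPDE

namespace EnergyTypeIVertex

/-- **Induction on scales** (constant aperture): a bounded scale function with a contracting self-similar recursion and an
O(r) inhomogeneity has order exactly 1 on (0, r₁]. [folklore] -/
theorem induction_on_scales (s : ℝ → ℝ) {E M A q r₁ : ℝ}
    (hsE : ∀ r, 0 < r → s r ≤ E) (hE : 0 ≤ E)
    (hM : 1 < M) (hA : 0 ≤ A) (hq : 0 ≤ q) (hqM : q * M ≤ 1 / 2) (hr₁ : 0 < r₁)
    (hrec : ∀ r, 0 < r → M * r ≤ r₁ → s r ≤ A * r + q * s (M * r)) :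
    ∀ r, 0 < r → r ≤ r₁ → s r ≤ max (E * M / r₁) (2 * A) * r := by
  set L : ℝ := max (E * M / r₁) (2 * A) with hL_def
  have hM0 : 0 < M := by linarith
  have hL1 : E * M / r₁ ≤ L := le_max_left _ _
  have hL2 : 2 * A ≤ L := le_max_right _ _
  have hbase : ∀ r, 0 < r → r₁ / M ≤ r → s r ≤ L * r := by
    intro r hr hrM
    have h1 : r₁ ≤ M * r := by rwa [div_le_iff₀ hM0, mul_comm] at hrM
    have h2 : E ≤ E * M / r₁ * r := by
      rw [div_mul_eq_mul_div, le_div_iff₀ hr₁]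
      nlinarith
    calc s r ≤ E := hsE r hr
      _ ≤ E * M / r₁ * r := h2
      _ ≤ L * r := mul_le_mul_of_nonneg_right hL1 hr.le
  have hclaim : ∀ k : ℕ, ∀ r, 0 < r → r₁ / M ^ (k + 1) ≤ r → r ≤ r₁ → s r ≤ L * r := by
    intro k
    induction k with
    | zero =>
      intro r hr hlo _
      exact hbase r hr (by simpa using hlo)
    | succ k ih =>
      intro r hr hlo hhi
      by_cases hcase : r₁ / M ≤ r
      · exact hbase r hr hcase
      · have hcase : r < r₁ / M := lt_of_not_ge hcase
        have hMr : M * r ≤ r₁ := by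
          have := (lt_div_iff₀ hM0).1 hcase
          linarith [this]
        have hMr0 : 0 < M * r := by positivity
        have hlo' : r₁ / M ^ (k + 1) ≤ M * r := by
          have hpow : (0 : ℝ) < M ^ (k + 1) := by positivity
          rw [div_le_iff₀ hpow]
          have : r₁ ≤ r * M ^ (k + 1 + 1) := by
            rwa [div_le_iff₀ (by positivity)] at hlo
          calc r₁ ≤ r * M ^ (k + 1 + 1) := this
            _ = M * r * M ^ (k + 1) := by ring
        have hprev := ih (M * r) hMr0 hlo' hMr
        calc s r ≤ A * r + q * s (M * r) := hrec r hr hMr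
          _ ≤ A * r + q * (L * (M * r)) := by
              have := mul_le_mul_of_nonneg_left hprev hq
              linarith
          _ = (A + q * M * L) * r := by ring
          _ ≤ (A + L / 2) * r := by
              apply mul_le_mul_of_nonneg_right _ hr.le
              nlinarith
          _ ≤ L * r := by
              apply mul_le_mul_of_nonneg_right _ hr.le
              linarith
  intro r hr hhi
  obtain ⟨n, hn⟩ := pow_unbounded_of_one_lt (r₁ / r) hM
  have hlo : r₁ / M ^ (n + 1) ≤ r := by
    have hpow : (0 : ℝ) < M ^ n := by positivity
    have h1 : r₁ / M ^ n < r := by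
      rw [div_lt_iff₀ hpow]
      rw [div_lt_iff₀ hr] at hn
      linarith [hn]
    have h2 : r₁ / M ^ (n + 1) ≤ r₁ / M ^ n := by
      apply div_le_div_of_nonneg_left hr₁.le hpow
      rw [pow_succ]
      exact le_mul_of_one_le_right hpow.le hM.le
    linarith
  exact hclaim n r hr hlo hhi

/-- **The E-letter conditional** over STℓ: on the classical Leray–Hopf frame, the √-clock and a parabolic-local
dissipation bound at `x₀` give a critical terminal scar at `x₀` (order exactly 1). [folklore] -/
theorem critScar_of_sqrtClock_of_parabolicDissipation
    (ν T : ℝ) (hν : 0 < ν) (hT : 0 < T)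
    (u : ℝ → EuclideanSpace ℝ (Fin 3) → EuclideanSpace ℝ (Fin 3)) (p : ℝ → EuclideanSpace ℝ (Fin 3) → ℝ)
    (hcl : IsClassicalNSSolutionOn (Ico 0 T) ν 0 u p) (hLH : IsLerayHopfOn T ν 0 (u 0) u)
    (hdec : HasRapidSpatialDecay (u 0))
    (hclock : ∃ K T₁ : ℝ, T₁ < T ∧ ∀ t ∈ Ioo T₁ T,
      ∫⁻ x, ‖u t x - u T x‖ₑ ^ 2 ≤ ENNReal.ofReal (K * Real.sqrt (T - t)))
    (x₀ : EuclideanSpace ℝ (Fin 3))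
    (hE : ∃ C ρ₁ : ℝ, 0 < ρ₁ ∧ ∀ ρ ∈ Ioo 0 ρ₁,
      ∫⁻ t in Ioo (T - ρ ^ 2) T, ∫⁻ x in ball x₀ ρ,
        ENNReal.ofReal (frobeniusNormSq (fderiv ℝ (u t) x)) ≤ ENNReal.ofReal (C * ρ)) :
    ∃ M r₁ : ℝ, 0 < r₁ ∧ ∀ r ∈ Ioo 0 r₁, r⁻¹ * ∫ x in ball x₀ r, ‖u T x‖ ^ 2 ≤ M := by
  obtain ⟨c₀, hc₀, hST⟩ := LocalWindowTradeoff.localWindowTradeoff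
  obtain ⟨K, T₁, hT₁, hK⟩ := hclock
  obtain ⟨C, ρ₁, hρ₁, hC⟩ := hE
  -- nonnegative constants
  set K' : ℝ := max K 0 with hK'_def
  set C' : ℝ := max C 0 with hC'_def
  have hK'0 : 0 ≤ K' := le_max_right _ _
  have hC'0 : 0 ≤ C' := le_max_right _ _
  -- aperture and radius threshold
  set M₀ : ℝ := max 4 (2 * c₀) with hM₀_def
  have hM4 : 4 ≤ M₀ := le_max_left _ _
  have hMc : 2 * c₀ ≤ M₀ := le_max_right _ _
  have hM0 : 0 < M₀ := by linarith
  have hM1 : 1 < M₀ := by linarith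
  set δ₀ : ℝ := min (T - T₁) T with hδ₀_def
  have hδ₀ : 0 < δ₀ := lt_min (sub_pos.mpr hT₁) hT
  have hδ₀1 : δ₀ ≤ T - T₁ := min_le_left _ _
  have hδ₀2 : δ₀ ≤ T := min_le_right _ _
  set r₁ : ℝ := min (Real.sqrt δ₀) (ρ₁ / 2) with hr₁_def
  have hr₁ : 0 < r₁ := lt_min (Real.sqrt_pos.mpr hδ₀) (by linarith)
  have hr₁s : r₁ ≤ Real.sqrt δ₀ := min_le_left _ _
  have hr₁ρ : r₁ ≤ ρ₁ / 2 := min_le_right _ _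
  -- the scale function and its global bound
  set s : ℝ → ℝ := fun r => ∫ x in ball x₀ r, ‖u T x‖ ^ 2 with hs_def
  have hmT : MemLp (u T) 2 volume := hLH.memLp T ⟨hT.le, le_rfl⟩
  have hint : Integrable (fun x => ‖u T x‖ ^ 2) volume := (memLp_two_iff_integrable_sq_norm hmT.1).1 hmT
  set E : ℝ := ∫ x, ‖u T x‖ ^ 2 with hE_def
  have hE0 : 0 ≤ E := integral_nonneg fun _ => sq_nonneg _
  have hsE : ∀ r, 0 < r → s r ≤ E := fun r _ =>
    setIntegral_le_integral hint (Eventually.of_forall fun _ => sq_nonneg _)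
  -- the recursion from STℓ at aperture M₀ and window r²
  have hrec : ∀ r, 0 < r → M₀ * r ≤ r₁ →
      s r ≤ 2 * (K' * r) + 16 * (r ^ 2 / (ν * r ^ 2)) * ((ν * C' * M₀) * r) +
        c₀ * (r / (M₀ * r)) ^ 2 * (K' * r + s (M₀ * r)) := by
    intro r hr hMr
    -- side conditions
    have hrr₁ : r < r₁ := by nlinarith
    have hrδ : r < Real.sqrt δ₀ := lt_of_lt_of_le hrr₁ hr₁s
    have hr2 : r ^ 2 < δ₀ := by
      have hs' : 0 < Real.sqrt δ₀ - r := sub_pos.mpr hrδ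
      have hp : 0 < Real.sqrt δ₀ + r := by positivity
      nlinarith [Real.sq_sqrt hδ₀.le, mul_pos hs' hp]
    have hτT : r ^ 2 < T := lt_of_lt_of_le hr2 hδ₀2
    have hτ : 0 < r ^ 2 := by positivity
    have hρ4 : 4 * r ≤ M₀ * r := by nlinarith
    have hMrρ₁ : M₀ * r < ρ₁ := by linarith
    have hMr0 : 0 < M₀ * r := by positivity
    have hH : 0 ≤ K' * r := by positivity
    have hL : 0 ≤ ν * C' * M₀ * r := by positivity
    -- clock on the window [T − r², T)
    have hmod : ∀ t ∈ Ico (T - r ^ 2) T, ∫⁻ x, ‖u t x - u T x‖ₑ ^ 2 ≤ ENNReal.ofReal (K' * r) := by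
      intro t ht
      have ht₁ : T₁ < t := by have := ht.1; linarith
      have hTt0 : 0 ≤ T - t := by have := ht.2; linarith
      have hsq : Real.sqrt (T - t) ≤ r := by
        rw [show r = Real.sqrt (r ^ 2) by rw [Real.sqrt_sq hr.le]]
        exact Real.sqrt_le_sqrt (by have := ht.1; linarith)
      refine (hK t ⟨ht₁, ht.2⟩).trans (ENNReal.ofReal_le_ofReal ?_)
      calc K * Real.sqrt (T - t) ≤ K' * Real.sqrt (T - t) :=
            mul_le_mul_of_nonneg_right (le_max_left _ _) (Real.sqrt_nonneg _)
        _ ≤ K' * r := mul_le_mul_of_nonneg_left hsq hK'0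
    -- dissipation on B_{M₀ r} × (T − r², T) from the E-letter bound at radius M₀ r
    have hdiss : ∫⁻ t in Ioo (T - r ^ 2) T, ∫⁻ x in ball x₀ (M₀ * r),
        ENNReal.ofReal (frobeniusNormSq (fderiv ℝ (u t) x)) ≤ ENNReal.ofReal (ν * C' * M₀ * r / ν) := by
      have hsub : Ioo (T - r ^ 2) T ⊆ Ioo (T - (M₀ * r) ^ 2) T := by
        refine Ioo_subset_Ioo ?_ le_rfl
        have : r ^ 2 ≤ (M₀ * r) ^ 2 := by nlinarith
        linarith
      have h1 := hC (M₀ * r) ⟨hMr0, hMrρ₁⟩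
      refine (lintegral_mono_set hsub).trans (h1.trans (ENNReal.ofReal_le_ofReal ?_))
      have : ν * C' * M₀ * r / ν = C' * (M₀ * r) := by field_simp
      rw [this]
      exact mul_le_mul_of_nonneg_right (le_max_left _ _) hMr0.le
    have h := hST ν T hν hT u p hcl hLH hdec x₀ r (M₀ * r) (r ^ 2) (K' * r) (ν * C' * M₀ * r)
      hr hρ4 hτ hτT hH hL hmod hdiss
    -- repackage the L-term
    have hLr : (ν * C' * M₀) * r = ν * C' * M₀ * r := by ring
    rw [hLr]
    exact h
  -- order exactly 1 by induction on scales (the #50c computation, inlined)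
  have hq : 0 ≤ c₀ / M₀ ^ 2 := by positivity
  have hqM : c₀ / M₀ ^ 2 * M₀ ≤ 1 / 2 := by
    rw [div_mul_eq_mul_div, pow_two, mul_div_mul_right _ _ hM0.ne', div_le_iff₀ hM0]
    linarith
  set A : ℝ := 2 * K' + 16 * (ν * C' * M₀) / ν + c₀ * K' / M₀ ^ 2 with hA_def
  have hA : 0 ≤ A := by positivity
  have hrec' : ∀ r, 0 < r → M₀ * r ≤ r₁ → s r ≤ A * r + c₀ / M₀ ^ 2 * s (M₀ * r) := by
    intro r hr hMr
    have h := hrec r hr hMr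
    have hr2 : r ^ 2 / (ν * r ^ 2) = 1 / ν := by field_simp
    have hrM : (r / (M₀ * r)) ^ 2 = 1 / M₀ ^ 2 := by
      rw [div_mul_eq_div_div_swap, div_self hr.ne', one_div, inv_pow]
      ring
    rw [hr2, hrM] at h
    have : 2 * (K' * r) + 16 * (1 / ν) * ((ν * C' * M₀) * r) + c₀ * (1 / M₀ ^ 2) * (K' * r + s (M₀ * r))
        = A * r + c₀ / M₀ ^ 2 * s (M₀ * r) := by
      rw [hA_def]; field_simp; ring
    linarith [this]
  have hmain := induction_on_scales s hsE hE0 hM1 hA hq hqM hr₁ hrec'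
  refine ⟨max (E * M₀ / r₁) (2 * A), r₁, hr₁, fun r hr => ?_⟩
  have h := hmain r hr.1 hr.2.le
  rw [inv_mul_le_iff₀ hr.1]
  linarith [h]

/-- **Cell form**: Uᶜ `CritTameScarIsCritical`'s frame (maximal smooth solution, Leray–Hopf, decaying datum, tame at `T`),
its √-clock hypothesis and its conclusion verbatim, with ONE inserted antecedent — the parabolic-local dissipation
bound at every vertex: «energy-Type-I vertices (E letter) ⟹ Uᶜ». [folklore] -/
theorem critTameScarIsCritical_of_parabolicDissipation :
    ∀ (ν T : ℝ), 0 < ν → 0 < T → ∀ (u : ℝ → EuclideanSpace ℝ (Fin 3) → EuclideanSpace ℝ (Fin 3))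
      (p : ℝ → EuclideanSpace ℝ (Fin 3) → ℝ),
      Literature.Analysis.FluidPDE.IsMaximalSmoothSolution ν 0 u p T →
      Literature.Analysis.FluidPDE.IsLerayHopfOn T ν 0 (u 0) u →
      Literature.Analysis.FluidPDE.HasRapidSpatialDecay (u 0) →
      Filter.Tendsto (fun t => MeasureTheory.eLpNorm (u t - u T) 2 MeasureTheory.volume) (nhdsWithin T (Set.Iio T))
        (nhds 0) →
      (∃ K T₁ : ℝ, T₁ < T ∧ ∀ t ∈ Set.Ioo T₁ T,
        ∫⁻ x, ‖u t x - u T x‖ₑ ^ 2 ≤ ENNReal.ofReal (K * Real.sqrt (T - t))) →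
      (∀ x₀ : EuclideanSpace ℝ (Fin 3), ∃ C ρ₁ : ℝ, 0 < ρ₁ ∧ ∀ ρ ∈ Set.Ioo 0 ρ₁,
        ∫⁻ t in Set.Ioo (T - ρ ^ 2) T, ∫⁻ x in Metric.ball x₀ ρ,
          ENNReal.ofReal (frobeniusNormSq (fderiv ℝ (u t) x)) ≤ ENNReal.ofReal (C * ρ)) →
      ∀ x₀ : EuclideanSpace ℝ (Fin 3), ∃ M r₁ : ℝ, 0 < r₁ ∧ ∀ r ∈ Set.Ioo 0 r₁,
        r⁻¹ * ∫ x in Metric.ball x₀ r, ‖u T x‖ ^ 2 ≤ M :=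
  fun ν T hν hT u p hmax hLH hdec _htame hclock hE x₀ =>
    critScar_of_sqrtClock_of_parabolicDissipation ν T hν hT u p hmax.1 hLH hdec hclock x₀ (hE x₀)

end EnergyTypeIVertex

end Summit.NavierStokesRegularity.NavierStokesRegularity.Theorems

end
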